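/-
Copyright (c) 2026 the pub-hodgecm-mathlib formalisation cell (harness21).  Prover seat hodgecm-mathlib-K2Liu-p13 (g4), Track B «K2-LIT»,
#184♮ = hLiu418 = `stmt-HodgeConjecture-24832`; U1-glob LEVEL 2 (K2E3-p14 (g9) slot table §B `htail`), brick GLUE (LEAD F0P6-plan (g14) BATCH #157 (2)), part (G-a)
TRANSPORT (box K2E5-r02 (g6) 23:41:18Z «=», guard (α): the A7 frame `(D, Q)` and the coordinates `e3` stay LETTERS): ★ p862989 `exists_twoStep_reading_of_forall_eq` (LH7-p06)
— the structured local reading of the singular Whittaker functional, its whole `∃ (A N₁ N₂ N₃ κ)` package — holds VERBATIM on ANY subgroup `N′ = unipDeltaLocal` with any Haar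
measure on it, in particular on ★ (E3)'s ∕ ★ FILE 2 p862998's global-comap subgroup `unipDeltaLoc v₀` (★ B1 `unipDeltaLoc_eq_unipDeltaLocal`; the ★ (E10c) `subst` pattern).
Part (G-b), the character dictionary `hchar` («`conj ψ_X(ι_{v₀} y) = conj ψ(σ_X·(e3⁻¹ y).1)`», ★ (d1) + ★ B1 §3 in a frame `Q` adapted to the corner index `X`), is a separate letter
(K2Liu-p12 ∕ LH7-p06 currency).  THEOREMS ONLY (no `def`, no `instance`, no named-fact hypothesis, no `sorry`).
-/
import Summits.HodgeConjecture.HodgeConjecture.Theorems.K2LiuSingularWhittakerLocalReading   -- ★ p862989 (LH7-p06)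
import Summits.HodgeConjecture.HodgeConjecture.Theorems.K2LiuRankOneCornerCharacterReading   -- ★ p862906 (K2E5-p16): ★ B1 `unipDeltaLoc_eq_unipDeltaLocal`, ★ `evalPlace_finPart_weylDelta`, `unipDeltaChar`
import HarnessLib

/-!
# Crux `HLiu418`, U1-glob LEVEL 2, GLUE: THE STRUCTURED SINGULAR-WHITTAKER READING ON `unipDeltaLoc v₀` AND ★ FILE 2's LOCAL FACTOR `= κ·N₃` MODULO `hchar`

Cell `hodgecm-mathlib`, crux item hLiu418 = `stmt-HodgeConjecture-24832` (helper lane, count-neutral).  ★ p862989's binders VERBATIM (generic doubled datum of rank `2`,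
A7 frame `(D, Dinv, Q)`, a `K₀`-flat family `f` of smooth Siegel sections, coordinates `e3` of the unipotent radical with `he3` through `frameConj Q ∘ nSiegel`, a local additive
character `ψ` with conductor exponent, `σ ≠ 0`, the non-split place letter `w, hw`, Haar data `μF, μw`) EXCEPT that the unipotent subgroup is a LETTER `N′` with
`hN′ : N′ = unipDeltaLocal` and `e3 : (F_v × E_v × F_v) ≃ₜ N′`, the Haar measure `ν` lives on `N′`, and the integrals run over `u : N′`:
§1 **`exists_twoStep_reading_of_eq_unipDeltaLocal`** — conclusion = ★ p862989's clauses (i)–(vi) byte for byte (`subst hN′`).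
§2 **`exists_twoStep_reading_unipDeltaLoc_cm`** — §1 at the K2Lit CM datum (`L⁺, L, complexConj, imagUnit, gramR, hermD`) on `N′ := unipDeltaLoc L e dV hdV dW hdW v₀`
(`hN′ :=` ★ B1 `unipDeltaLoc_eq_unipDeltaLocal`) with the Weyl letter respelled `evalPlace v₀ (finPart w_Δ)` (★ `evalPlace_finPart_weylDelta`) — ★ FILE 2's carrier and letter;
the A7 frame `(D, Dinv, Q)` and the coordinates `e3` stay LETTERS (box K2E5-r02 (α)).
§3 **`exists_localFactor_reading_of_hchar`** — with (G-b)'s dictionary `hchar : ∀ y, conj ψ_X(ι_{v₀} y) = conj ψ(σ·(e3⁻¹ y).1)` BY VALUE (★ p862906 for the corner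
`X = single 1 1 σ₀` of record, ★ (K1a-1) p862643): `∃ N₃ κ`, `N₃` `q`-rational-regular everywhere, `κ` on `0 < re`, `κ·N₃(h)` holomorphic on `{0 < re s}`, the `κ`-formula (v), and
★ FILE 2 p862998's local factor `∫ conj ψ_X(ι_{v₀} y) · f_s((w_Δ)_{v₀} · y · h) dνN(y) = κ s · N₃ s h` on `1 < re s` — U1-glob LEVEL 1's `htail` local half at `bT := f`.
§4 **`hchar_corner_of_record`** (ED. 2, (G-b) inline) — §3's `hchar` DISCHARGED for the corner index of record `X = single 1 1 σ₀` in the ADAPTED frame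
(`hDinv : Dinv = 2·W·gramR`): `ψ := adeleAddCharAt (Fp L) v₀`, `σ := −ι(gramR 1 1 · Tr(σ₀·imagUnit))` — ★ p862906 + `conj ψ(x) = ψ(−x)` (`conj_coe_addChar_eq_neg`).
§5 **`exists_localFactor_reading_of_hchar_full`** (ED. 3, desk K2E3-p14) — §3 with the FULL witness tuple `(A, N₁, N₂, N₃, κ)` and ALL of ★ p862989's clauses (i)–(vi) kept
((iii) through `hchar`), so `Fn := κ·N₃` (LEVEL 2-fin) and FILE B's `N₃(½) = 0` ((iv)+(v)) are about the SAME `N₃`.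
Sources: [KudlaRallis1994, §2]; [Casselman1980, §3 Thm. 3.1]; [CasselmanShalika1980, §2]; [KudlaSweet1997, §1]; [MoeglinWaldspurger1995, I.2.1]; [Kudla1994, §3].
HONEST LABEL.  Helper lemma, count-neutral; `HC_CM` is proved only modulo the 7 printed citations (2 remaining named inputs:
hLiu418 = `stmt-HodgeConjecture-24832`, h413 = `stmt-HodgeConjecture-24833`) until rung 0 closes.
-/

set_option autoImplicit false
set_option linter.dupNamespace false -- the mandated namespace repeats `HodgeConjecture.HodgeConjecture`

noncomputable section

open scoped Classical NNReal ENNReal ComplexConjugate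
open NumberField IsDedekindDomain Matrix MeasureTheory Topology
open Literature.NumberTheory.GaloisRepresentations.IsNonarchimedeanLocalField
open Literature.NumberTheory.Automorphic Literature.NumberTheory.Automorphic.UnitaryGroup
open Literature.NumberTheory.GelbartRogawski1991.AdaptedBlocks
open Literature.NumberTheory.GelbartRogawski1991.UnitaryDualPair.LocalSplitting
open Literature.NumberTheory.K2Lit.LocalSiegelDoubled
open Summit.HodgeConjecture.HodgeConjecture.Cruxes.HLiu418.K2LiuQRationalDefs
open Summit.HodgeConjecture.HodgeConjecture.Cruxes.HLiu418.K2LiuQRationalLFactor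
open Summit.HodgeConjecture.HodgeConjecture.Cruxes.HLiu418.K2LiuLocalLFactorDefs
open Summit.HodgeConjecture.HodgeConjecture.Cruxes.HLiu418.K2LiuLocalSiegelIwasawaFrame
open Summit.HodgeConjecture.HodgeConjecture.Cruxes.HLiu418.K2LiuLocalSiegelIwasawa
open Summit.HodgeConjecture.HodgeConjecture.Cruxes.HLiu418.K2LiuDoubledUTwoTwoBorelFrame
open Summit.HodgeConjecture.HodgeConjecture.Cruxes.HLiu418.K2LiuDoubledUTwoTwoWeylCocycle
open Summit.HodgeConjecture.HodgeConjecture.Cruxes.HLiu418.K2LiuDoubledUTwoTwoLevi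
open Summit.HodgeConjecture.HodgeConjecture.Cruxes.HLiu418.K2LiuDoubledUTwoTwoFrameTransport
open Summit.HodgeConjecture.HodgeConjecture.Cruxes.HLiu418.K2LiuDoubledUTwoTwoUnipotentCoordinates
open Summit.HodgeConjecture.HodgeConjecture.Cruxes.HLiu418.K2LiuDoubledUTwoTwoUnipotentHaar
open Summit.HodgeConjecture.HodgeConjecture.Cruxes.HLiu418.K2LiuDoubledUTwoTwoLeviTransport
open Summit.HodgeConjecture.HodgeConjecture.Cruxes.HLiu418.K2LiuUnipDeltaRankOneCoordinates
open Summit.HodgeConjecture.HodgeConjecture.Cruxes.HLiu418.K2LiuSiegelCocycleLetters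
open Summit.HodgeConjecture.HodgeConjecture.Cruxes.HLiu418.K2LiuSiegelCocycleStageLetters
open Summit.HodgeConjecture.HodgeConjecture.Cruxes.HLiu418.K2LiuSiegelCocycleStageShort
open Summit.HodgeConjecture.HodgeConjecture.Cruxes.HLiu418.K2LiuSiegelCocycleChainShort
open Summit.HodgeConjecture.HodgeConjecture.Cruxes.HLiu418.K2LiuSiegelCocycleChainLong
open Summit.HodgeConjecture.HodgeConjecture.Cruxes.HLiu418.K2LiuIteratedRankOneCocycle
open Summit.HodgeConjecture.HodgeConjecture.Cruxes.HLiu418.K2LiuSiegelIntertwiningCocycle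
open Summit.HodgeConjecture.HodgeConjecture.Cruxes.HLiu418.K2LiuRankOneStage
open Summit.HodgeConjecture.HodgeConjecture.Cruxes.HLiu418.K2LiuRankOneStageTwisted
open Summit.HodgeConjecture.HodgeConjecture.Cruxes.HLiu418.K2LiuFlatSiegelFamilies
open Summit.HodgeConjecture.HodgeConjecture.Cruxes.HLiu418.K2LiuLocalRingPlaceDecomposition
open Summit.HodgeConjecture.HodgeConjecture.Cruxes.HLiu418.K2LiuRankOneOperators
open Summit.HodgeConjecture.HodgeConjecture.Cruxes.HLiu418.K2LiuRankOneLevelShells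
open Summit.HodgeConjecture.HodgeConjecture.Cruxes.HLiu418.K2LiuRankOneLevelHolomorphy
open Summit.HodgeConjecture.HodgeConjecture.Cruxes.HLiu418.K2LiuSingularWhittakerLocalReading (exists_twoStep_reading_of_forall_eq)

namespace Summit.HodgeConjecture.HodgeConjecture.Cruxes.HLiu418.K2LiuSingularWhittakerTailGlue

/-! ## §1 The generic transport to a subgroup letter `N′ = unipDeltaLocal` -/

section Generic

variable (F : Type) [Field F] [NumberField F] (E : Type) [Field E] [NumberField E] [Algebra F E]
  [Algebra.IsQuadraticExtension F E] (c : E ≃ₐ[F] E)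
  {δ : E} (hcδ : c δ = -δ) (hδ : δ ≠ 0) {d : F} (hd : δ * δ = algebraMap F E d) (v : HeightOneSpectrum (𝓞 F))
  {T₂ : Matrix (Fin 2) (Fin 2) F} (hT₂ : T₂.IsSymm) {J₂D : Matrix (Fin (2 + 2)) (Fin (2 + 2)) E} (hJ₂D : J₂D = (gramD F 2 T₂).map (algebraMap F E))
  (D Dinv : Matrix (Fin 2) (Fin 2) F) (hDD : D * Dinv = 1) (hDD' : Dinv * D = 1) (Q : GL (Fin (2 + 2)) F)
  (hQm : (Q : Matrix (Fin (2 + 2)) (Fin (2 + 2)) F) = Matrix.reindex (e₂ 2) (e₂ 2) (Matrix.fromBlocks 1 D 1 (-D)))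
  (hQ : (Q : Matrix (Fin (2 + 2)) (Fin (2 + 2)) F)ᵀ * gramD F 2 T₂ * (Q : Matrix (Fin (2 + 2)) (Fin (2 + 2)) F) = (StdForm.antidiagonal (2 + 2)).over F)


include hcδ hδ hd hT₂ hDD hQm hQ in
set_option maxHeartbeats 400000 in -- as ★ p862989 (measured there: the binder telescope of the chain, `whnf` > 200 000); `subst` + `exact`
/-- **(G-a) TRANSPORT: ★ p862989's STRUCTURED LOCAL READING ON ANY SUBGROUP `N′ = unipDeltaLocal`** (e.g. the global-comap `unipDeltaLoc v₀` of ★ FILE 2 p862998 via ★ B1):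
binders and conclusion (i)–(vi) VERBATIM, with the unipotent subgroup a letter `N′`, `hN′ : N′ = unipDeltaLocal`, coordinates `e3 : _ ≃ₜ N′`, Haar `νN` on `N′`, `u : N′` (`subst`).
[cite: KudlaRallis1994, §2] [cite: Casselman1980, §3 Thm. 3.1] [cite: CasselmanShalika1980, §2] [cite: KudlaSweet1997, §1] [cite: MoeglinWaldspurger1995, I.2.1] -/
theorem exists_twoStep_reading_of_eq_unipDeltaLocal {N' : Subgroup (UnitaryGroup.localPi E c (2 + 2) J₂D v)} (hN' : N' = unipDeltaLocal F E c v 2 (JD := J₂D))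
    [MeasurableSpace (N')] [BorelSpace (N')]
    (νN : Measure (N')) [νN.IsHaarMeasure]
    [MeasurableSpace (v.adicCompletion F)] [BorelSpace (v.adicCompletion F)] (μF : Measure (v.adicCompletion F)) [μF.IsAddHaarMeasure]
    (χv : ∀ w : PlacesOver E v, (w.1.adicCompletion E)ˣ →* ℂˣ) (hχ : ∀ (w' : PlacesOver E v) (x : (w'.1.adicCompletion E)ˣ), ‖((χv w' x : ℂˣ) : ℂ)‖ = 1)
    (K₀ : Subgroup (UnitaryGroup.localPi E c (2 + 2) J₂D v))
    (hK₀ : IsCompact (K₀ : Set (UnitaryGroup.localPi E c (2 + 2) J₂D v)) ∧ IsOpen (K₀ : Set (UnitaryGroup.localPi E c (2 + 2) J₂D v)))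
    (hIw : ∀ g : UnitaryGroup.localPi E c (2 + 2) J₂D v, ∃ p, IsSiegelDelta F E c hcδ hδ hd v 2 hT₂ hJ₂D p ∧ ∃ k ∈ K₀, g = p * k)
    (f : ℂ → UnitaryGroup.localPi E c (2 + 2) J₂D v → ℂ) (hSieg : ∀ s, IsLocalSiegelSection F E c hcδ hδ hd v 2 hT₂ hJ₂D χv s (f s)) (hsm : ∀ s, IsSmooth F E c v 2 (f s))
    (hflat : ∀ s s' : ℂ, ∀ k ∈ K₀, f s k = f s' k)
    (e3 : (v.adicCompletion F × UnitaryGroup.LocalRing E v × v.adicCompletion F) ≃ₜ N')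
    (he3 : ∀ b₁ z b₂, ((e3 (b₁, z, b₂) : N') : UnitaryGroup.localPi E c (2 + 2) J₂D v) =
      FrameTransport.frameConj F E c v (2 + 2) hJ₂D (antidiagonal_over_eq_map F E 2) Q hQ
        (toLocalFour F E c v (nSiegel (UnitaryGroup.LocalRing E v) (UnitaryGroup.conjLocal E c v) (UnitaryGroup.conjLocal_conjLocal c v hcδ hδ)
          (UnitaryGroup.toLocalRing E v b₁ * algebraMap E (UnitaryGroup.LocalRing E v) δ) z
          (UnitaryGroup.toLocalRing E v b₂ * algebraMap E (UnitaryGroup.LocalRing E v) δ)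
          (conjLocal_coord F E c hcδ v b₁) (conjLocal_coord F E c hcδ v b₂))))
    (he3mul : ∀ p p', e3 (p + p') = e3 p * e3 p')
    (ψ : AddChar (v.adicCompletion F) Circle) (hψ : Continuous ψ) {mψ : ℤ} (hmψ : ψ.HasConductorExp mψ) {σ : v.adicCompletion F} (hσ : σ ≠ 0)
    (w : PlacesOver E v) (hw : ∀ w' : PlacesOver E v, w' = w)
    [MeasurableSpace (w.1.adicCompletion E)] [BorelSpace (w.1.adicCompletion E)] (μw : Measure (w.1.adicCompletion E)) [μw.IsAddHaarMeasure] :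
    ∃ (A : GL (Fin 2) (UnitaryGroup.LocalRing E v)) (N₁ N₂ N₃ : ℂ → UnitaryGroup.localPi E c (2 + 2) J₂D v → ℂ) (κ : ℂ → ℂ),
      A.val = !![1 - Pi.single w 1, Pi.single w 1; Pi.single w 1, 1 - Pi.single w 1] ∧
      (∀ (s₀ : ℂ) (g : UnitaryGroup.localPi E c (2 + 2) J₂D v), IsQRationalRegularAt (residueFieldCard (v.adicCompletion F)) s₀ fun s => N₂ s g) ∧
      (∀ (s₀ : ℂ) (g : UnitaryGroup.localPi E c (2 + 2) J₂D v), IsQRationalRegularAt (residueFieldCard (v.adicCompletion F)) s₀ fun s => N₃ s g) ∧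
      (∀ s₀ : ℂ, 0 < s₀.re → IsQRationalRegularAt (residueFieldCard (v.adicCompletion F)) s₀ κ) ∧
      (∀ h : UnitaryGroup.localPi E c (2 + 2) J₂D v, DifferentiableOn ℂ (fun s => κ s * N₃ s h) {s : ℂ | 0 < s.re}) ∧
      (∀ s : ℂ, 1 < s.re → ∀ h : UnitaryGroup.localPi E c (2 + 2) J₂D v,
        ∫ u, conj ((ψ (σ * (e3.symm u).1) : ℂ)) * f s (weylDelta F E c v 2 hJ₂D (T₀ := T₂) * (u : UnitaryGroup.localPi E c (2 + 2) J₂D v) * h) ∂νN = κ s * N₃ s h) ∧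
      (∀ s : ℂ, 1 < s.re → ∀ h : UnitaryGroup.localPi E c (2 + 2) J₂D v,
        Integrable (fun x => conj ((ψ (σ * x) : ℂ)) * N₂ s (FrameTransport.frameConj F E c v (2 + 2) hJ₂D (antidiagonal_over_eq_map F E 2) Q hQ (toLocalFour F E c v (weylTwo (UnitaryGroup.LocalRing E v) (UnitaryGroup.conjLocal E c v))) * FrameTransport.frameConj F E c v (2 + 2) hJ₂D (antidiagonal_over_eq_map F E 2) Q hQ (toLocalFour F E c v (uLongTwo (UnitaryGroup.LocalRing E v) (UnitaryGroup.conjLocal E c v) (UnitaryGroup.toLocalRing E v x * algebraMap E (UnitaryGroup.LocalRing E v) δ) (conjLocal_coord F E c hcδ v x))) * h)) μF ∧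
          ∫ x, conj ((ψ (σ * x) : ℂ)) * N₂ s (FrameTransport.frameConj F E c v (2 + 2) hJ₂D (antidiagonal_over_eq_map F E 2) Q hQ (toLocalFour F E c v (weylTwo (UnitaryGroup.LocalRing E v) (UnitaryGroup.conjLocal E c v))) * FrameTransport.frameConj F E c v (2 + 2) hJ₂D (antidiagonal_over_eq_map F E 2) Q hQ (toLocalFour F E c v (uLongTwo (UnitaryGroup.LocalRing E v) (UnitaryGroup.conjLocal E c v) (UnitaryGroup.toLocalRing E v x * algebraMap E (UnitaryGroup.LocalRing E v) δ) (conjLocal_coord F E c hcδ v x))) * h) ∂μF = N₃ s h) ∧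
      (∀ s₀ : ℂ, (∀ g : UnitaryGroup.localPi E c (2 + 2) J₂D v, N₂ s₀ g = 0) → ∀ h : UnitaryGroup.localPi E c (2 + 2) J₂D v, N₃ s₀ h = 0) ∧
      (∀ s : ℂ, 1 < s.re →
        (∀ g : UnitaryGroup.localPi E c (2 + 2) J₂D v, N₁ s g = (lF F E v χv (2 * s + 1))⁻¹ * ∫ y, f s (FrameTransport.frameConj F E c v (2 + 2) hJ₂D (antidiagonal_over_eq_map F E 2) Q hQ (toLocalFour F E c v (weylTwo (UnitaryGroup.LocalRing E v) (UnitaryGroup.conjLocal E c v))) * FrameTransport.frameConj F E c v (2 + 2) hJ₂D (antidiagonal_over_eq_map F E 2) Q hQ (toLocalFour F E c v (uLongTwo (UnitaryGroup.LocalRing E v) (UnitaryGroup.conjLocal E c v) (UnitaryGroup.toLocalRing E v y * algebraMap E (UnitaryGroup.LocalRing E v) δ) (conjLocal_coord F E c hcδ v y))) * g) ∂μF) ∧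
        (∀ g : UnitaryGroup.localPi E c (2 + 2) J₂D v, N₂ s g = (lEN F E c v χv (2 * s))⁻¹ * ∫ ζ, N₁ s (FrameTransport.frameConj F E c v (2 + 2) hJ₂D (antidiagonal_over_eq_map F E 2) Q hQ (toLocalFour F E c v (leviElt (UnitaryGroup.LocalRing E v) (UnitaryGroup.conjLocal E c v) (UnitaryGroup.conjLocal_conjLocal c v hcδ hδ) A)) * FrameTransport.frameConj F E c v (2 + 2) hJ₂D (antidiagonal_over_eq_map F E 2) Q hQ (toLocalFour F E c v (uMinus (UnitaryGroup.LocalRing E v) (UnitaryGroup.conjLocal E c v) (UnitaryGroup.conjLocal_conjLocal c v hcδ hδ) (Pi.single w ζ))) * g) ∂μw)) ∧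
      (∃ cN : ℝ≥0, 0 < cN ∧ ∀ s : ℂ, κ s = localSiegelCharacter F E c v 2 χv s (weylDelta F E c v 2 hJ₂D (T₀ := T₂) * FrameTransport.frameConj F E c v (2 + 2) hJ₂D (antidiagonal_over_eq_map F E 2) Q hQ (toLocalFour F E c v (weylSiegel (UnitaryGroup.LocalRing E v) (UnitaryGroup.conjLocal E c v)))) * (((cN : ℝ) : ℂ) * (lF F E v χv (2 * s + 1) * lEN F E c v χv (2 * s)))) := by
  subst hN'
  exact exists_twoStep_reading_of_forall_eq F E c hcδ hδ hd v hT₂ hJ₂D D Dinv hDD Q hQm hQ νN μF χv hχ K₀ hK₀ hIw f hSieg hsm hflat e3 he3 he3mul ψ hψ hmψ hσ w hw μw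

end Generic

/-! ## §2 The CM instance on ★ FILE 2's subgroup `unipDeltaLoc v₀`, with `(w_Δ)_{v₀} = evalPlace v₀ (finPart w_Δ)` -/

section CM

open Literature.NumberTheory.GaloisRepresentations
open Literature.NumberTheory.GelbartRogawski1991 Literature.NumberTheory.GelbartRogawski1991.GRConstruction
open Literature.NumberTheory.GelbartRogawski1991.UnitaryDualPair
open Summit.HodgeConjecture.HodgeConjecture.Cruxes.HLiu418.K2LiuSiegelUnipotentLocalDefs (unipDeltaLoc)
open Summit.HodgeConjecture.HodgeConjecture.Cruxes.HLiu418.K2LiuSiegelUnipotentFourierDefs (unipDeltaChar)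
open Summit.HodgeConjecture.HodgeConjecture.Cruxes.HLiu418.K2LiuUnipDeltaLocBridge (unipDeltaLoc_eq_unipDeltaLocal)
open Summit.HodgeConjecture.HodgeConjecture.Cruxes.HLiu418.K2LiuLocalWhittakerFactorSkew (evalPlace_finPart_weylDelta)

variable (L : Type) [Field L] [NumberField L] [IsCMField L] {N M : ℕ} (e : Fin N × Fin M ≃ Fin 2)
  (dV : Fin N → L) (hdV : ∀ i, IsCMField.complexConj L (dV i) = dV i) (dW : Fin M → L) (hdW : ∀ i, IsCMField.complexConj L (dW i) = dW i)
  (v₀ : HeightOneSpectrum (𝓞 (Fp L)))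
  -- the A7 frame at `v₀` of the CM datum `T₂ = gramR` — LETTERS (box K2E5-r02 (α)): `(D, Dinv, Q)`
  (D Dinv : Matrix (Fin 2) (Fin 2) (Fp L)) (hDD : D * Dinv = 1) (Q : GL (Fin (2 + 2)) (Fp L))
  (hQm : (Q : Matrix (Fin (2 + 2)) (Fin (2 + 2)) (Fp L)) = Matrix.reindex (e₂ 2) (e₂ 2) (Matrix.fromBlocks 1 D 1 (-D)))
  (hQ : (Q : Matrix (Fin (2 + 2)) (Fin (2 + 2)) (Fp L))ᵀ * gramD (Fp L) 2 (gramR L e dV hdV dW hdW) * (Q : Matrix (Fin (2 + 2)) (Fin (2 + 2)) (Fp L)) =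
    (StdForm.antidiagonal (2 + 2)).over (Fp L))

include hDD hQm in
set_option maxHeartbeats 1600000 in -- MEASURED 2026-09-05: 800 000 ✗ (`whnf`∕`isDefEq` in the application of §1 at the K2Lit CM telescope, even split into `have`s), 1 600 000 ✓; as ★ p862797
/-- **(G-a) AT THE CM DATUM ON `unipDeltaLoc v₀` (★ FILE 2 p862998's carrier and Weyl letter).**  ★ p862989's package (i)–(vi) for the K2Lit CM doubled datum
(`F = L⁺`, `E = L`, `c = complexConj`, `δ = imagUnit`, `T₂ = gramR`, `J₂D = hermD`) at a finite place `v₀`, for ANY Haar measure `νN` on ★ (E3)'s `unipDeltaLoc v₀`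
(★ B1 `unipDeltaLoc_eq_unipDeltaLocal`) and with the local Weyl element spelled `evalPlace v₀ (finPart w_Δ)` (★ `evalPlace_finPart_weylDelta`); the A7 frame `(D, Dinv, Q)`,
the coordinates `e3` (`he3` through `frameConj Q ∘ nSiegel`), `ψ, σ ≠ 0, w, μF, μw, χv, K₀, f` are LETTERS exactly as in ★ p862989.  With (G-b)'s dictionary
`hchar : conj ψ_X(ι_{v₀} y) = conj ψ(σ·(e3⁻¹ y).1)` clause (iii) IS ★ FILE 2's local factor (§3).
[cite: KudlaRallis1994, §2] [cite: Casselman1980, §3 Thm. 3.1] [cite: KudlaSweet1997, §1] [cite: Kudla1994, §3] [cite: HarrisKudlaSweet1996, §1 (1.11)] -/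
theorem exists_twoStep_reading_unipDeltaLoc_cm
    [MeasurableSpace (unipDeltaLoc L e dV hdV dW hdW v₀)] [BorelSpace (unipDeltaLoc L e dV hdV dW hdW v₀)]
    (νN : Measure (unipDeltaLoc L e dV hdV dW hdW v₀)) [νN.IsHaarMeasure]
    [MeasurableSpace (v₀.adicCompletion (Fp L))] [BorelSpace (v₀.adicCompletion (Fp L))] (μF : Measure (v₀.adicCompletion (Fp L))) [μF.IsAddHaarMeasure]
    (χv : ∀ w : PlacesOver L v₀, (w.1.adicCompletion L)ˣ →* ℂˣ) (hχ : ∀ (w' : PlacesOver L v₀) (x : (w'.1.adicCompletion L)ˣ), ‖((χv w' x : ℂˣ) : ℂ)‖ = 1)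
    (K₀ : Subgroup (UnitaryGroup.localPi L (IsCMField.complexConj L) (2 + 2) (hermD L e dV hdV dW hdW) v₀))
    (hK₀ : IsCompact (K₀ : Set (UnitaryGroup.localPi L (IsCMField.complexConj L) (2 + 2) (hermD L e dV hdV dW hdW) v₀)) ∧ IsOpen (K₀ : Set (UnitaryGroup.localPi L (IsCMField.complexConj L) (2 + 2) (hermD L e dV hdV dW hdW) v₀)))
    (hIw : haveI : Algebra.IsQuadraticExtension (Fp L) L := IsCMField.isQuadraticExtension L
      ∀ g : UnitaryGroup.localPi L (IsCMField.complexConj L) (2 + 2) (hermD L e dV hdV dW hdW) v₀, ∃ p, IsSiegelDelta (Fp L) L (IsCMField.complexConj L) (complexConj_imagUnit L) (imagUnit_ne_zero L) (imagUnit_mul_self L) v₀ 2 (gramR_isSymm L e dV hdV dW hdW) (hermD_eq_map_gramD L e dV hdV dW hdW) p ∧ ∃ k ∈ K₀, g = p * k)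
    (f : ℂ → UnitaryGroup.localPi L (IsCMField.complexConj L) (2 + 2) (hermD L e dV hdV dW hdW) v₀ → ℂ) (hSieg : haveI : Algebra.IsQuadraticExtension (Fp L) L := IsCMField.isQuadraticExtension L
      ∀ s, IsLocalSiegelSection (Fp L) L (IsCMField.complexConj L) (complexConj_imagUnit L) (imagUnit_ne_zero L) (imagUnit_mul_self L) v₀ 2 (gramR_isSymm L e dV hdV dW hdW) (hermD_eq_map_gramD L e dV hdV dW hdW) χv s (f s)) (hsm : ∀ s, IsSmooth (Fp L) L (IsCMField.complexConj L) v₀ 2 (f s))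
    (hflat : ∀ s s' : ℂ, ∀ k ∈ K₀, f s k = f s' k)
    (e3 : (v₀.adicCompletion (Fp L) × UnitaryGroup.LocalRing L v₀ × v₀.adicCompletion (Fp L)) ≃ₜ unipDeltaLoc L e dV hdV dW hdW v₀)
    (he3 : haveI : Algebra.IsQuadraticExtension (Fp L) L := IsCMField.isQuadraticExtension L
      ∀ b₁ z b₂, ((e3 (b₁, z, b₂) : unipDeltaLoc L e dV hdV dW hdW v₀) : UnitaryGroup.localPi L (IsCMField.complexConj L) (2 + 2) (hermD L e dV hdV dW hdW) v₀) =
      FrameTransport.frameConj (Fp L) L (IsCMField.complexConj L) v₀ (2 + 2) (hermD_eq_map_gramD L e dV hdV dW hdW) (antidiagonal_over_eq_map (Fp L) L 2) Q hQ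
        (toLocalFour (Fp L) L (IsCMField.complexConj L) v₀ (nSiegel (UnitaryGroup.LocalRing L v₀) (UnitaryGroup.conjLocal L (IsCMField.complexConj L) v₀) (UnitaryGroup.conjLocal_conjLocal (IsCMField.complexConj L) v₀ (complexConj_imagUnit L) (imagUnit_ne_zero L))
          (UnitaryGroup.toLocalRing L v₀ b₁ * algebraMap L (UnitaryGroup.LocalRing L v₀) (imagUnit L)) z
          (UnitaryGroup.toLocalRing L v₀ b₂ * algebraMap L (UnitaryGroup.LocalRing L v₀) (imagUnit L))
          (conjLocal_coord (Fp L) L (IsCMField.complexConj L) (complexConj_imagUnit L) v₀ b₁) (conjLocal_coord (Fp L) L (IsCMField.complexConj L) (complexConj_imagUnit L) v₀ b₂))))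
    (he3mul : ∀ p p', e3 (p + p') = e3 p * e3 p')
    (ψ : AddChar (v₀.adicCompletion (Fp L)) Circle) (hψ : Continuous ψ) {mψ : ℤ} (hmψ : ψ.HasConductorExp mψ) {σ : v₀.adicCompletion (Fp L)} (hσ : σ ≠ 0)
    (w : PlacesOver L v₀) (hw : ∀ w' : PlacesOver L v₀, w' = w)
    [MeasurableSpace (w.1.adicCompletion L)] [BorelSpace (w.1.adicCompletion L)] (μw : Measure (w.1.adicCompletion L)) [μw.IsAddHaarMeasure] :
    haveI : Algebra.IsQuadraticExtension (Fp L) L := IsCMField.isQuadraticExtension L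
    ∃ (A : GL (Fin 2) (UnitaryGroup.LocalRing L v₀)) (N₁ N₂ N₃ : ℂ → UnitaryGroup.localPi L (IsCMField.complexConj L) (2 + 2) (hermD L e dV hdV dW hdW) v₀ → ℂ) (κ : ℂ → ℂ),
      A.val = !![1 - Pi.single w 1, Pi.single w 1; Pi.single w 1, 1 - Pi.single w 1] ∧
      (∀ (s₀ : ℂ) (g : UnitaryGroup.localPi L (IsCMField.complexConj L) (2 + 2) (hermD L e dV hdV dW hdW) v₀), IsQRationalRegularAt (residueFieldCard (v₀.adicCompletion (Fp L))) s₀ fun s => N₂ s g) ∧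
      (∀ (s₀ : ℂ) (g : UnitaryGroup.localPi L (IsCMField.complexConj L) (2 + 2) (hermD L e dV hdV dW hdW) v₀), IsQRationalRegularAt (residueFieldCard (v₀.adicCompletion (Fp L))) s₀ fun s => N₃ s g) ∧
      (∀ s₀ : ℂ, 0 < s₀.re → IsQRationalRegularAt (residueFieldCard (v₀.adicCompletion (Fp L))) s₀ κ) ∧
      (∀ h : UnitaryGroup.localPi L (IsCMField.complexConj L) (2 + 2) (hermD L e dV hdV dW hdW) v₀, DifferentiableOn ℂ (fun s => κ s * N₃ s h) {s : ℂ | 0 < s.re}) ∧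
      (∀ s : ℂ, 1 < s.re → ∀ h : UnitaryGroup.localPi L (IsCMField.complexConj L) (2 + 2) (hermD L e dV hdV dW hdW) v₀,
        ∫ u, conj ((ψ (σ * (e3.symm u).1) : ℂ)) * f s (UnitaryGroup.evalPlace (Fp L) L (IsCMField.complexConj L) (2 + 2) (hermD L e dV hdV dW hdW) v₀ (UnitaryGroup.finPart (Fp L) L (IsCMField.complexConj L) (2 + 2) (hermD L e dV hdV dW hdW) (Literature.NumberTheory.K2Lit.SiegelDoubled.weylDelta L e dV hdV dW hdW)) * (u : UnitaryGroup.localPi L (IsCMField.complexConj L) (2 + 2) (hermD L e dV hdV dW hdW) v₀) * h) ∂νN = κ s * N₃ s h) ∧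
      (∀ s : ℂ, 1 < s.re → ∀ h : UnitaryGroup.localPi L (IsCMField.complexConj L) (2 + 2) (hermD L e dV hdV dW hdW) v₀,
        Integrable (fun x => conj ((ψ (σ * x) : ℂ)) * N₂ s (FrameTransport.frameConj (Fp L) L (IsCMField.complexConj L) v₀ (2 + 2) (hermD_eq_map_gramD L e dV hdV dW hdW) (antidiagonal_over_eq_map (Fp L) L 2) Q hQ (toLocalFour (Fp L) L (IsCMField.complexConj L) v₀ (weylTwo (UnitaryGroup.LocalRing L v₀) (UnitaryGroup.conjLocal L (IsCMField.complexConj L) v₀))) * FrameTransport.frameConj (Fp L) L (IsCMField.complexConj L) v₀ (2 + 2) (hermD_eq_map_gramD L e dV hdV dW hdW) (antidiagonal_over_eq_map (Fp L) L 2) Q hQ (toLocalFour (Fp L) L (IsCMField.complexConj L) v₀ (uLongTwo (UnitaryGroup.LocalRing L v₀) (UnitaryGroup.conjLocal L (IsCMField.complexConj L) v₀) (UnitaryGroup.toLocalRing L v₀ x * algebraMap L (UnitaryGroup.LocalRing L v₀) (imagUnit L)) (conjLocal_coord (Fp L) L (IsCMField.complexConj L) (complexConj_imagUnit L) v₀ x)))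 * h)) μF ∧
          ∫ x, conj ((ψ (σ * x) : ℂ)) * N₂ s (FrameTransport.frameConj (Fp L) L (IsCMField.complexConj L) v₀ (2 + 2) (hermD_eq_map_gramD L e dV hdV dW hdW) (antidiagonal_over_eq_map (Fp L) L 2) Q hQ (toLocalFour (Fp L) L (IsCMField.complexConj L) v₀ (weylTwo (UnitaryGroup.LocalRing L v₀) (UnitaryGroup.conjLocal L (IsCMField.complexConj L) v₀))) * FrameTransport.frameConj (Fp L) L (IsCMField.complexConj L) v₀ (2 + 2) (hermD_eq_map_gramD L e dV hdV dW hdW) (antidiagonal_over_eq_map (Fp L) L 2) Q hQ (toLocalFour (Fp L) L (IsCMField.complexConj L) v₀ (uLongTwo (UnitaryGroup.LocalRing L v₀) (UnitaryGroup.conjLocal L (IsCMField.complexConj L) v₀) (UnitaryGroup.toLocalRing L v₀ x * algebraMap L (UnitaryGroup.LocalRing L v₀) (imagUnit L)) (conjLocal_coord (Fp L) L (IsCMField.complexConj L) (complexConj_imagUnit L) v₀ x))) * h) ∂μF = N₃ s h) ∧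
      (∀ s₀ : ℂ, (∀ g : UnitaryGroup.localPi L (IsCMField.complexConj L) (2 + 2) (hermD L e dV hdV dW hdW) v₀, N₂ s₀ g = 0) → ∀ h : UnitaryGroup.localPi L (IsCMField.complexConj L) (2 + 2) (hermD L e dV hdV dW hdW) v₀, N₃ s₀ h = 0) ∧
      (∀ s : ℂ, 1 < s.re →
        (∀ g : UnitaryGroup.localPi L (IsCMField.complexConj L) (2 + 2) (hermD L e dV hdV dW hdW) v₀, N₁ s g = (lF (Fp L) L v₀ χv (2 * s + 1))⁻¹ * ∫ y, f s (FrameTransport.frameConj (Fp L) L (IsCMField.complexConj L) v₀ (2 + 2) (hermD_eq_map_gramD L e dV hdV dW hdW) (antidiagonal_over_eq_map (Fp L) L 2) Q hQ (toLocalFour (Fp L) L (IsCMField.complexConj L) v₀ (weylTwo (UnitaryGroup.LocalRing L v₀) (UnitaryGroup.conjLocal L (IsCMField.complexConj L) v₀))) * FrameTransport.frameConj (Fp L) L (IsCMField.complexConj L) v₀ (2 + 2) (hermD_eq_map_gramD L e dV hdV dW hdW) (antidiagonal_over_eq_map (Fp L) L 2) Q hQ (toLocalFour (Fp L) L (IsCMField.complexConj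 L) v₀ (uLongTwo (UnitaryGroup.LocalRing L v₀) (UnitaryGroup.conjLocal L (IsCMField.complexConj L) v₀) (UnitaryGroup.toLocalRing L v₀ y * algebraMap L (UnitaryGroup.LocalRing L v₀) (imagUnit L)) (conjLocal_coord (Fp L) L (IsCMField.complexConj L) (complexConj_imagUnit L) v₀ y))) * g) ∂μF) ∧
        (∀ g : UnitaryGroup.localPi L (IsCMField.complexConj L) (2 + 2) (hermD L e dV hdV dW hdW) v₀, N₂ s g = (lEN (Fp L) L (IsCMField.complexConj L) v₀ χv (2 * s))⁻¹ * ∫ ζ, N₁ s (FrameTransport.frameConj (Fp L) L (IsCMField.complexConj L) v₀ (2 + 2) (hermD_eq_map_gramD L e dV hdV dW hdW) (antidiagonal_over_eq_map (Fp L) L 2) Q hQ (toLocalFour (Fp L) L (IsCMField.complexConj L) v₀ (leviElt (UnitaryGroup.LocalRing L v₀) (UnitaryGroup.conjLocal L (IsCMField.complexConj L) v₀) (UnitaryGroup.conjLocal_conjLocal (IsCMField.complexConj L) v₀ (complexConj_imagUnit L) (imagUnit_ne_zero L)) A)) * FrameTransport.frameConj (Fp L) L (IsCMField.complexConj L) v₀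 (2 + 2) (hermD_eq_map_gramD L e dV hdV dW hdW) (antidiagonal_over_eq_map (Fp L) L 2) Q hQ (toLocalFour (Fp L) L (IsCMField.complexConj L) v₀ (uMinus (UnitaryGroup.LocalRing L v₀) (UnitaryGroup.conjLocal L (IsCMField.complexConj L) v₀) (UnitaryGroup.conjLocal_conjLocal (IsCMField.complexConj L) v₀ (complexConj_imagUnit L) (imagUnit_ne_zero L)) (Pi.single w ζ))) * g) ∂μw)) ∧
      (∃ cN : ℝ≥0, 0 < cN ∧ ∀ s : ℂ, κ s = localSiegelCharacter (Fp L) L (IsCMField.complexConj L) v₀ 2 χv s (UnitaryGroup.evalPlace (Fp L) L (IsCMField.complexConj L) (2 + 2) (hermD L e dV hdV dW hdW) v₀ (UnitaryGroup.finPart (Fp L) L (IsCMField.complexConj L) (2 + 2) (hermD L e dV hdV dW hdW) (Literature.NumberTheory.K2Lit.SiegelDoubled.weylDelta L e dV hdV dW hdW)) * FrameTransport.frameConj (Fp L) L (IsCMField.complexConj L) v₀ (2 + 2) (hermD_eq_map_gramD L e dV hdV dW hdW) (antidiagonal_over_eq_map (Fp L) L 2) Q hQ (toLocalFour (Fp L)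 L (IsCMField.complexConj L) v₀ (weylSiegel (UnitaryGroup.LocalRing L v₀) (UnitaryGroup.conjLocal L (IsCMField.complexConj L) v₀)))) * (((cN : ℝ) : ℂ) * (lF (Fp L) L v₀ χv (2 * s + 1) * lEN (Fp L) L (IsCMField.complexConj L) v₀ χv (2 * s))))
:= by
  haveI : Algebra.IsQuadraticExtension (Fp L) L := IsCMField.isQuadraticExtension L
  -- §1 applied binder group by binder group, then `rw`/`exact` (a one-shot `exact`∕`have` of the whole application times out at 800 000: the ★ (E10c) pattern)
  have h₀ := exists_twoStep_reading_of_eq_unipDeltaLocal (Fp L) L (IsCMField.complexConj L) (complexConj_imagUnit L) (imagUnit_ne_zero L)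
    (imagUnit_mul_self L) v₀ (gramR_isSymm L e dV hdV dW hdW) (hermD_eq_map_gramD L e dV hdV dW hdW) D Dinv hDD Q hQm hQ
    (N' := unipDeltaLoc L e dV hdV dW hdW v₀) (unipDeltaLoc_eq_unipDeltaLocal L e dV hdV dW hdW v₀) νN μF χv hχ K₀ hK₀
  have h₁ := h₀ hIw f
  have h₂ := h₁ hSieg
  have h₃ := h₂ hsm hflat e3
  have h₄ := h₃ he3
  have h := h₄ he3mul ψ hψ hmψ hσ w hw μw
  rw [evalPlace_finPart_weylDelta L e dV hdV dW hdW v₀]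
  exact h


include hDD hQm in
set_option maxHeartbeats 800000 in -- MEASURED class (§2's statement instance; ★ FILE 2 p862998: 400 000 ✗, 800 000 ✓)
/-- **(G) THE `htail` LOCAL HALF OF U1-glob LEVEL 1 AT `v₀`: ★ FILE 2's LOCAL FACTOR `= κ(s) · N₃(s, h_{v₀})`, MODULO THE CHARACTER DICTIONARY `hchar` (G-b).**
§2's letters, an index `X` and, BY VALUE, (G-b)'s reading of the global character in the coordinates `e3` of the frame `Q` (★ p862906
`conj_unipDeltaChar_single_locToAdelic_frameConj_nSiegel` for the corner `X = single 1 1 σ₀` of record, ★ (K1a-1) p862643: `ψ := ψ_{L⁺,v₀}`, `σ := −ι(gramR 1 1 · Tr(σ₀ δ))`):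
`hchar : ∀ y, conj ψ_X(ι_{v₀} y) = conj ψ(σ · (e3⁻¹ y).1)`.  THEN there are `N₃ : ℂ → H_{v₀} → ℂ` (`q_{v₀}`-rational-regular at EVERY `s₀`) and `κ : ℂ → ℂ` (`q_{v₀}`-rational-regular on
`0 < re s₀`; `κ = c_w(s)·cN·L_F(2s+1)·L_E^N(2s)`, clause (v)) with `s ↦ κ s · N₃ s h` holomorphic on `{0 < re s}` and, for `1 < re s` and every `h ∈ H_{v₀}`,
`∫_{N_Δ(L⁺_{v₀})} conj ψ_X(ι_{v₀} y) · f_s((w_Δ)_{v₀} · y · h) dνN(y) = κ s · N₃ s h` — ★ FILE 2 p862998's local factor at `bT := f`, `h := h_{v₀}` (§2 (iii) + `integral_congr_ae`).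
[cite: KudlaRallis1994, §2] [cite: Casselman1980, §3 Thm. 3.1] [cite: KudlaSweet1997, §1] [cite: Tan1999, §3] -/
theorem exists_localFactor_reading_of_hchar
    [MeasurableSpace (unipDeltaLoc L e dV hdV dW hdW v₀)] [BorelSpace (unipDeltaLoc L e dV hdV dW hdW v₀)]
    (νN : Measure (unipDeltaLoc L e dV hdV dW hdW v₀)) [νN.IsHaarMeasure]
    [MeasurableSpace (v₀.adicCompletion (Fp L))] [BorelSpace (v₀.adicCompletion (Fp L))] (μF : Measure (v₀.adicCompletion (Fp L))) [μF.IsAddHaarMeasure]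
    (χv : ∀ w : PlacesOver L v₀, (w.1.adicCompletion L)ˣ →* ℂˣ) (hχ : ∀ (w' : PlacesOver L v₀) (x : (w'.1.adicCompletion L)ˣ), ‖((χv w' x : ℂˣ) : ℂ)‖ = 1)
    (K₀ : Subgroup (UnitaryGroup.localPi L (IsCMField.complexConj L) (2 + 2) (hermD L e dV hdV dW hdW) v₀))
    (hK₀ : IsCompact (K₀ : Set (UnitaryGroup.localPi L (IsCMField.complexConj L) (2 + 2) (hermD L e dV hdV dW hdW) v₀)) ∧ IsOpen (K₀ : Set (UnitaryGroup.localPi L (IsCMField.complexConj L) (2 + 2) (hermD L e dV hdV dW hdW) v₀)))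
    (hIw : haveI : Algebra.IsQuadraticExtension (Fp L) L := IsCMField.isQuadraticExtension L
      ∀ g : UnitaryGroup.localPi L (IsCMField.complexConj L) (2 + 2) (hermD L e dV hdV dW hdW) v₀, ∃ p, IsSiegelDelta (Fp L) L (IsCMField.complexConj L) (complexConj_imagUnit L) (imagUnit_ne_zero L) (imagUnit_mul_self L) v₀ 2 (gramR_isSymm L e dV hdV dW hdW) (hermD_eq_map_gramD L e dV hdV dW hdW) p ∧ ∃ k ∈ K₀, g = p * k)
    (f : ℂ → UnitaryGroup.localPi L (IsCMField.complexConj L) (2 + 2) (hermD L e dV hdV dW hdW) v₀ → ℂ) (hSieg : haveI : Algebra.IsQuadraticExtension (Fp L) L := IsCMField.isQuadraticExtension L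
      ∀ s, IsLocalSiegelSection (Fp L) L (IsCMField.complexConj L) (complexConj_imagUnit L) (imagUnit_ne_zero L) (imagUnit_mul_self L) v₀ 2 (gramR_isSymm L e dV hdV dW hdW) (hermD_eq_map_gramD L e dV hdV dW hdW) χv s (f s)) (hsm : ∀ s, IsSmooth (Fp L) L (IsCMField.complexConj L) v₀ 2 (f s))
    (hflat : ∀ s s' : ℂ, ∀ k ∈ K₀, f s k = f s' k)
    (e3 : (v₀.adicCompletion (Fp L) × UnitaryGroup.LocalRing L v₀ × v₀.adicCompletion (Fp L)) ≃ₜ unipDeltaLoc L e dV hdV dW hdW v₀)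
    (he3 : haveI : Algebra.IsQuadraticExtension (Fp L) L := IsCMField.isQuadraticExtension L
      ∀ b₁ z b₂, ((e3 (b₁, z, b₂) : unipDeltaLoc L e dV hdV dW hdW v₀) : UnitaryGroup.localPi L (IsCMField.complexConj L) (2 + 2) (hermD L e dV hdV dW hdW) v₀) =
      FrameTransport.frameConj (Fp L) L (IsCMField.complexConj L) v₀ (2 + 2) (hermD_eq_map_gramD L e dV hdV dW hdW) (antidiagonal_over_eq_map (Fp L) L 2) Q hQ
        (toLocalFour (Fp L) L (IsCMField.complexConj L) v₀ (nSiegel (UnitaryGroup.LocalRing L v₀) (UnitaryGroup.conjLocal L (IsCMField.complexConj L) v₀) (UnitaryGroup.conjLocal_conjLocal (IsCMField.complexConj L) v₀ (complexConj_imagUnit L) (imagUnit_ne_zero L))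
          (UnitaryGroup.toLocalRing L v₀ b₁ * algebraMap L (UnitaryGroup.LocalRing L v₀) (imagUnit L)) z
          (UnitaryGroup.toLocalRing L v₀ b₂ * algebraMap L (UnitaryGroup.LocalRing L v₀) (imagUnit L))
          (conjLocal_coord (Fp L) L (IsCMField.complexConj L) (complexConj_imagUnit L) v₀ b₁) (conjLocal_coord (Fp L) L (IsCMField.complexConj L) (complexConj_imagUnit L) v₀ b₂))))
    (he3mul : ∀ p p', e3 (p + p') = e3 p * e3 p')
    (ψ : AddChar (v₀.adicCompletion (Fp L)) Circle) (hψ : Continuous ψ) {mψ : ℤ} (hmψ : ψ.HasConductorExp mψ) {σ : v₀.adicCompletion (Fp L)} (hσ : σ ≠ 0)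
    (w : PlacesOver L v₀) (hw : ∀ w' : PlacesOver L v₀, w' = w)
    [MeasurableSpace (w.1.adicCompletion L)] [BorelSpace (w.1.adicCompletion L)] (μw : Measure (w.1.adicCompletion L)) [μw.IsAddHaarMeasure]
    (X : Matrix (Fin 2) (Fin 2) L)
    (hchar : ∀ y : ↥(unipDeltaLoc L e dV hdV dW hdW v₀), conj (unipDeltaChar L e dV hdV dW hdW X (locToAdelic L e dV hdV dW hdW v₀ (y : UnitaryGroup.localPi L (IsCMField.complexConj L) (2 + 2) (hermD L e dV hdV dW hdW) v₀)) : ℂ) = conj ((ψ (σ * (e3.symm y).1) : ℂ))) :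
    haveI : Algebra.IsQuadraticExtension (Fp L) L := IsCMField.isQuadraticExtension L
    ∃ (N₃ : ℂ → UnitaryGroup.localPi L (IsCMField.complexConj L) (2 + 2) (hermD L e dV hdV dW hdW) v₀ → ℂ) (κ : ℂ → ℂ),
      (∀ (s₀ : ℂ) (g : UnitaryGroup.localPi L (IsCMField.complexConj L) (2 + 2) (hermD L e dV hdV dW hdW) v₀), IsQRationalRegularAt (residueFieldCard (v₀.adicCompletion (Fp L))) s₀ fun s => N₃ s g) ∧
      (∀ s₀ : ℂ, 0 < s₀.re → IsQRationalRegularAt (residueFieldCard (v₀.adicCompletion (Fp L))) s₀ κ) ∧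
      (∀ h : UnitaryGroup.localPi L (IsCMField.complexConj L) (2 + 2) (hermD L e dV hdV dW hdW) v₀, DifferentiableOn ℂ (fun s => κ s * N₃ s h) {s : ℂ | 0 < s.re}) ∧
      (∀ s : ℂ, 1 < s.re → ∀ h : UnitaryGroup.localPi L (IsCMField.complexConj L) (2 + 2) (hermD L e dV hdV dW hdW) v₀,
        ∫ y, conj (unipDeltaChar L e dV hdV dW hdW X (locToAdelic L e dV hdV dW hdW v₀ (y : UnitaryGroup.localPi L (IsCMField.complexConj L) (2 + 2) (hermD L e dV hdV dW hdW) v₀)) : ℂ) * f s (UnitaryGroup.evalPlace (Fp L) L (IsCMField.complexConj L) (2 + 2) (hermD L e dV hdV dW hdW) v₀ (UnitaryGroup.finPart (Fp L) L (IsCMField.complexConj L) (2 + 2) (hermD L e dV hdV dW hdW) (Literature.NumberTheory.K2Lit.SiegelDoubled.weylDelta L e dV hdV dW hdW)) * (y : UnitaryGroup.localPi L (IsCMField.complexConj L) (2 + 2) (hermD L e dV hdV dW hdW) v₀) * h) ∂νN = κ s * N₃ s h) ∧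
      (∃ cN : ℝ≥0, 0 < cN ∧ ∀ s : ℂ, κ s = localSiegelCharacter (Fp L) L (IsCMField.complexConj L) v₀ 2 χv s (UnitaryGroup.evalPlace (Fp L) L (IsCMField.complexConj L) (2 + 2) (hermD L e dV hdV dW hdW) v₀ (UnitaryGroup.finPart (Fp L) L (IsCMField.complexConj L) (2 + 2) (hermD L e dV hdV dW hdW) (Literature.NumberTheory.K2Lit.SiegelDoubled.weylDelta L e dV hdV dW hdW)) * FrameTransport.frameConj (Fp L) L (IsCMField.complexConj L) v₀ (2 + 2) (hermD_eq_map_gramD L e dV hdV dW hdW) (antidiagonal_over_eq_map (Fp L) L 2) Q hQ (toLocalFour (Fp L) L (IsCMField.complexConj L) v₀ (weylSiegel (UnitaryGroup.LocalRing L v₀) (UnitaryGroup.conjLocal L (IsCMField.complexConj L) v₀)))) * (((cN : ℝ) : ℂ) * (lF (Fp L) L v₀ χv (2 * s + 1) * lEN (Fp L) L (IsCMField.complexConj L) v₀ χv (2 * s)))) := by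
  haveI : Algebra.IsQuadraticExtension (Fp L) L := IsCMField.isQuadraticExtension L
  obtain ⟨_A, _N₁, _N₂, N₃, κ, _hA, _hN₂, hN₃, hκ, hdiff, hiii, _hN₃int, _hvan, _hform, hcN⟩ :=
    exists_twoStep_reading_unipDeltaLoc_cm L e dV hdV dW hdW v₀ D Dinv hDD Q hQm hQ νN μF χv hχ K₀ hK₀ hIw f hSieg hsm hflat e3 he3 he3mul ψ hψ hmψ hσ w hw μw
  refine ⟨N₃, κ, hN₃, hκ, hdiff, fun s hs h => ?_, hcN⟩
  rw [← hiii s hs h]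
  refine integral_congr_ae (ae_of_all _ fun y => ?_)
  beta_reduce
  rw [hchar y]

end CM

/-! ## §4 (G-b) inline: the character dictionary `hchar` for the corner index of record, from ★ p862906 -/

section Corner

open Literature.NumberTheory.GaloisRepresentations
open Literature.NumberTheory.GelbartRogawski1991 Literature.NumberTheory.GelbartRogawski1991.GRConstruction
open Literature.NumberTheory.GelbartRogawski1991.UnitaryDualPair
open Summit.HodgeConjecture.HodgeConjecture.Cruxes.HLiu418.K2LiuSiegelUnipotentLocalDefs (unipDeltaLoc)
open Summit.HodgeConjecture.HodgeConjecture.Cruxes.HLiu418.K2LiuSiegelUnipotentFourierDefs (unipDeltaChar)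
open Summit.HodgeConjecture.HodgeConjecture.Cruxes.HLiu418.K2LiuRankOneCornerCharacterReading (conj_unipDeltaChar_single_locToAdelic_frameConj_nSiegel)

variable (L : Type) [Field L] [NumberField L] [IsCMField L] {N M : ℕ} (e : Fin N × Fin M ≃ Fin 2)
  (dV : Fin N → L) (hdV : ∀ i, IsCMField.complexConj L (dV i) = dV i) (dW : Fin M → L) (hdW : ∀ i, IsCMField.complexConj L (dW i) = dW i)
  (v₀ : HeightOneSpectrum (𝓞 (Fp L)))
  -- the ADAPTED frame of ★ p862906 ∕ ★ `exists_adaptedFrame_eq` at the diagonal CM Gram datum: `(D, Dinv, Q)` with the explicit `Dinv = 2·W·gramR`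
  (D Dinv : Matrix (Fin 2) (Fin 2) (Fp L)) (hDD : D * Dinv = 1) (Q : GL (Fin (2 + 2)) (Fp L))
  (hQm : (Q : Matrix (Fin (2 + 2)) (Fin (2 + 2)) (Fp L)) = Matrix.reindex (e₂ 2) (e₂ 2) (Matrix.fromBlocks 1 D 1 (-D)))
  (hQ : (Q : Matrix (Fin (2 + 2)) (Fin (2 + 2)) (Fp L))ᵀ * gramD (Fp L) 2 (gramR L e dV hdV dW hdW) * (Q : Matrix (Fin (2 + 2)) (Fin (2 + 2)) (Fp L)) =
    (StdForm.antidiagonal (2 + 2)).over (Fp L))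
  (hDinv : Dinv = (2 : Fp L) • ((1 : Matrix (Fin 2) (Fin 2) (Fp L)).submatrix Fin.rev id * gramR L e dV hdV dW hdW))

/-- `conj (ψ x) = ψ (−x)` for an additive character into the circle. [folklore] -/
theorem conj_coe_addChar_eq_neg {A : Type*} [AddGroup A] (ψ : AddChar A Circle) (x : A) : conj ((ψ x : Circle) : ℂ) = ((ψ (-x) : Circle) : ℂ) := by
  rw [AddChar.map_neg_eq_inv, Circle.coe_inv_eq_conj]

include hDD hQm hDinv in
set_option maxHeartbeats 400000 in -- MEASURED class (★ p862906's statement at the K2Lit CM telescope)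
/-- **(G-b) THE CHARACTER DICTIONARY FOR THE CORNER OF RECORD.**  In ★ p862989's coordinates `e3` of `N_Δ(L⁺_{v₀})` (any `e3 : L⁺_{v₀} × (L ⊗ L⁺_{v₀}) × L⁺_{v₀} ≃ₜ unipDeltaLoc v₀`
reading through the adapted frame, `he3 : ↑(e3 (b₁, z, b₂)) = frameConj Q (toLocalFour (nSiegel (ι b₁·δ) z (ι b₂·δ)))`, `δ = imagUnit L`) the global character at the corner index
`X = single 1 1 σ₀` reads, for EVERY `y`,  `conj ψ_X(ι_{v₀} y) = conj ψ(σ · (e3⁻¹ y).1)`  with  `ψ := ψ_{L⁺,v₀} = adeleAddCharAt (Fp L) v₀`  and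
`σ := −ι_{v₀}(gramR 1 1 · Tr_{L∕L⁺}(σ₀ δ))` — ★ p862906 `conj_unipDeltaChar_single_locToAdelic_frameConj_nSiegel` (which gives `ψ(b₁ · ι(gramR 1 1 · Tr(σ₀δ)))`) + `conj ψ(x) = ψ(−x)`.
This is §3's `hchar` BY NAME for the corner of record (★ (K1a-1) p862643 reduces every rank-one skew index to it); `σ ≠ 0` iff `Tr(σ₀ δ) ≠ 0` (`gramR 1 1 ≠ 0`), e.g. `σ₀ ∉ L⁺`.
[cite: Shimura1997, §18.1 (18.4)] [cite: HarrisKudlaSweet1996, §1 (1.11)–(1.12)] [cite: KudlaRallis1994, §2] -/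
theorem hchar_corner_of_record
    (e3 : (v₀.adicCompletion (Fp L) × UnitaryGroup.LocalRing L v₀ × v₀.adicCompletion (Fp L)) ≃ₜ unipDeltaLoc L e dV hdV dW hdW v₀)
    (he3 : haveI : Algebra.IsQuadraticExtension (Fp L) L := IsCMField.isQuadraticExtension L
      ∀ b₁ z b₂, ((e3 (b₁, z, b₂) : unipDeltaLoc L e dV hdV dW hdW v₀) : UnitaryGroup.localPi L (IsCMField.complexConj L) (2 + 2) (hermD L e dV hdV dW hdW) v₀) =
      FrameTransport.frameConj (Fp L) L (IsCMField.complexConj L) v₀ (2 + 2) (hermD_eq_map_gramD L e dV hdV dW hdW) (antidiagonal_over_eq_map (Fp L) L 2) Q hQ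
        (toLocalFour (Fp L) L (IsCMField.complexConj L) v₀ (nSiegel (UnitaryGroup.LocalRing L v₀) (UnitaryGroup.conjLocal L (IsCMField.complexConj L) v₀)
          (UnitaryGroup.conjLocal_conjLocal (IsCMField.complexConj L) v₀ (complexConj_imagUnit L) (imagUnit_ne_zero L))
          (UnitaryGroup.toLocalRing L v₀ b₁ * algebraMap L (UnitaryGroup.LocalRing L v₀) (imagUnit L)) z
          (UnitaryGroup.toLocalRing L v₀ b₂ * algebraMap L (UnitaryGroup.LocalRing L v₀) (imagUnit L))
          (conjLocal_coord (Fp L) L (IsCMField.complexConj L) (complexConj_imagUnit L) v₀ b₁) (conjLocal_coord (Fp L) L (IsCMField.complexConj L) (complexConj_imagUnit L) v₀ b₂))))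
    (σ₀ : L) :
    ∀ y : ↥(unipDeltaLoc L e dV hdV dW hdW v₀),
      conj (unipDeltaChar L e dV hdV dW hdW (Matrix.single 1 1 σ₀) (locToAdelic L e dV hdV dW hdW v₀ (y : UnitaryGroup.localPi L (IsCMField.complexConj L) (2 + 2) (hermD L e dV hdV dW hdW) v₀)) : ℂ) =
        conj ((adeleAddCharAt (Fp L) v₀
          (-(algebraMap (Fp L) (v₀.adicCompletion (Fp L)) (gramR L e dV hdV dW hdW 1 1 * Algebra.trace (Fp L) L (σ₀ * imagUnit L))) * (e3.symm y).1) : ℂ)) := by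
  intro y
  obtain ⟨⟨b₁, z, b₂⟩, rfl⟩ := e3.surjective y
  rw [Homeomorph.symm_apply_apply, he3 b₁ z b₂,
    conj_unipDeltaChar_single_locToAdelic_frameConj_nSiegel L e dV hdV dW hdW v₀ D Dinv hDD Q hQm hQ hDinv σ₀ b₁ z b₂, conj_coe_addChar_eq_neg, neg_mul, neg_neg,
    mul_comm b₁]

end Corner

section Full -- §5 (ED. 3): §3 with the FULL witness tuple `(A, N₁, N₂, N₃, κ)` and all of ★ p862989's clauses kept
open Literature.NumberTheory.GaloisRepresentations Literature.NumberTheory.GelbartRogawski1991 Literature.NumberTheory.GelbartRogawski1991.GRConstruction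
open Literature.NumberTheory.GelbartRogawski1991.UnitaryDualPair
open Summit.HodgeConjecture.HodgeConjecture.Cruxes.HLiu418.K2LiuSiegelUnipotentLocalDefs (unipDeltaLoc)
open Summit.HodgeConjecture.HodgeConjecture.Cruxes.HLiu418.K2LiuSiegelUnipotentFourierDefs (unipDeltaChar)

variable (L : Type) [Field L] [NumberField L] [IsCMField L] {N M : ℕ} (e : Fin N × Fin M ≃ Fin 2) (dV : Fin N → L) (hdV : ∀ i, IsCMField.complexConj L (dV i) = dV i)
  (dW : Fin M → L) (hdW : ∀ i, IsCMField.complexConj L (dW i) = dW i) (v₀ : HeightOneSpectrum (𝓞 (Fp L))) (D Dinv : Matrix (Fin 2) (Fin 2) (Fp L)) (hDD : D * Dinv = 1)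
  (Q : GL (Fin (2 + 2)) (Fp L)) (hQm : (Q : Matrix (Fin (2 + 2)) (Fin (2 + 2)) (Fp L)) = Matrix.reindex (e₂ 2) (e₂ 2) (Matrix.fromBlocks 1 D 1 (-D)))
  (hQ : (Q : Matrix (Fin (2 + 2)) (Fin (2 + 2)) (Fp L))ᵀ * gramD (Fp L) 2 (gramR L e dV hdV dW hdW) * (Q : Matrix (Fin (2 + 2)) (Fin (2 + 2)) (Fp L)) = (StdForm.antidiagonal (2 + 2)).over (Fp L))
include hDD hQm in
set_option maxHeartbeats 800000 in -- MEASURED class (as §3: §2's statement instance at the K2Lit CM telescope)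
/-- **(G, FULL TUPLE) ★ FILE 2's LOCAL FACTOR `= κ·N₃` WITH ★ p862989's WHOLE PACKAGE FOR THE SAME WITNESSES** (the ∃-witness seam, desk K2E3-p14, box K2E5-r02).
§3's binders (`hchar` BY VALUE; §4 pays it for the corner of record); conclusion = §2's tuple `(A, N₁, N₂, N₃, κ)` with ALL clauses (i)–(vi), clause (iii) now with the GLOBAL
character `∫ conj ψ_X(ι_{v₀} u) · f_s((w_Δ)_{v₀}·u·h) dνN(u) = κ s · N₃ s h` on `1 < re s`; so LEVEL 2-fin's `Fn := κ·N₃` and FILE B's `N₃(½) = 0` ((iv)+(v)) are about the SAME `N₃`.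
Proof = §2 + `integral_congr_ae` ∘ `hchar`, every component kept. [cite: KudlaRallis1994, §2] [cite: Casselman1980, §3 Thm. 3.1] [cite: KudlaSweet1997, §1] -/
theorem exists_localFactor_reading_of_hchar_full
    [MeasurableSpace (unipDeltaLoc L e dV hdV dW hdW v₀)] [BorelSpace (unipDeltaLoc L e dV hdV dW hdW v₀)] (νN : Measure (unipDeltaLoc L e dV hdV dW hdW v₀)) [νN.IsHaarMeasure]
    [MeasurableSpace (v₀.adicCompletion (Fp L))] [BorelSpace (v₀.adicCompletion (Fp L))] (μF : Measure (v₀.adicCompletion (Fp L))) [μF.IsAddHaarMeasure]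
    (χv : ∀ w : PlacesOver L v₀, (w.1.adicCompletion L)ˣ →* ℂˣ) (hχ : ∀ (w' : PlacesOver L v₀) (x : (w'.1.adicCompletion L)ˣ), ‖((χv w' x : ℂˣ) : ℂ)‖ = 1)
    (K₀ : Subgroup (UnitaryGroup.localPi L (IsCMField.complexConj L) (2 + 2) (hermD L e dV hdV dW hdW) v₀)) (hK₀ : IsCompact (K₀ : Set (UnitaryGroup.localPi L (IsCMField.complexConj L) (2 + 2) (hermD L e dV hdV dW hdW) v₀)) ∧ IsOpen (K₀ : Set (UnitaryGroup.localPi L (IsCMField.complexConj L) (2 + 2) (hermD L e dV hdV dW hdW) v₀)))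
    (hIw : haveI : Algebra.IsQuadraticExtension (Fp L) L := IsCMField.isQuadraticExtension L; ∀ g : UnitaryGroup.localPi L (IsCMField.complexConj L) (2 + 2) (hermD L e dV hdV dW hdW) v₀, ∃ p, IsSiegelDelta (Fp L) L (IsCMField.complexConj L) (complexConj_imagUnit L) (imagUnit_ne_zero L) (imagUnit_mul_self L) v₀ 2 (gramR_isSymm L e dV hdV dW hdW) (hermD_eq_map_gramD L e dV hdV dW hdW) p ∧ ∃ k ∈ K₀, g = p * k)
    (f : ℂ → UnitaryGroup.localPi L (IsCMField.complexConj L) (2 + 2) (hermD L e dV hdV dW hdW) v₀ → ℂ) (hSieg : haveI : Algebra.IsQuadraticExtension (Fp L) L := IsCMField.isQuadraticExtension L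
      ∀ s, IsLocalSiegelSection (Fp L) L (IsCMField.complexConj L) (complexConj_imagUnit L) (imagUnit_ne_zero L) (imagUnit_mul_self L) v₀ 2 (gramR_isSymm L e dV hdV dW hdW) (hermD_eq_map_gramD L e dV hdV dW hdW) χv s (f s)) (hsm : ∀ s, IsSmooth (Fp L) L (IsCMField.complexConj L) v₀ 2 (f s)) (hflat : ∀ s s' : ℂ, ∀ k ∈ K₀, f s k = f s' k)
    (e3 : (v₀.adicCompletion (Fp L) × UnitaryGroup.LocalRing L v₀ × v₀.adicCompletion (Fp L)) ≃ₜ unipDeltaLoc L e dV hdV dW hdW v₀)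
    (he3 : haveI : Algebra.IsQuadraticExtension (Fp L) L := IsCMField.isQuadraticExtension L; ∀ b₁ z b₂, ((e3 (b₁, z, b₂) : unipDeltaLoc L e dV hdV dW hdW v₀) : UnitaryGroup.localPi L (IsCMField.complexConj L) (2 + 2) (hermD L e dV hdV dW hdW) v₀) =
      FrameTransport.frameConj (Fp L) L (IsCMField.complexConj L) v₀ (2 + 2) (hermD_eq_map_gramD L e dV hdV dW hdW) (antidiagonal_over_eq_map (Fp L) L 2) Q hQ
        (toLocalFour (Fp L) L (IsCMField.complexConj L) v₀ (nSiegel (UnitaryGroup.LocalRing L v₀) (UnitaryGroup.conjLocal L (IsCMField.complexConj L) v₀) (UnitaryGroup.conjLocal_conjLocal (IsCMField.complexConj L) v₀ (complexConj_imagUnit L) (imagUnit_ne_zero L))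
          (UnitaryGroup.toLocalRing L v₀ b₁ * algebraMap L (UnitaryGroup.LocalRing L v₀) (imagUnit L)) z
          (UnitaryGroup.toLocalRing L v₀ b₂ * algebraMap L (UnitaryGroup.LocalRing L v₀) (imagUnit L))
          (conjLocal_coord (Fp L) L (IsCMField.complexConj L) (complexConj_imagUnit L) v₀ b₁) (conjLocal_coord (Fp L) L (IsCMField.complexConj L) (complexConj_imagUnit L) v₀ b₂)))) (he3mul : ∀ p p', e3 (p + p') = e3 p * e3 p')
    (ψ : AddChar (v₀.adicCompletion (Fp L)) Circle) (hψ : Continuous ψ) {mψ : ℤ} (hmψ : ψ.HasConductorExp mψ) {σ : v₀.adicCompletion (Fp L)} (hσ : σ ≠ 0)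
    (w : PlacesOver L v₀) (hw : ∀ w' : PlacesOver L v₀, w' = w) [MeasurableSpace (w.1.adicCompletion L)] [BorelSpace (w.1.adicCompletion L)] (μw : Measure (w.1.adicCompletion L)) [μw.IsAddHaarMeasure]
    (X : Matrix (Fin 2) (Fin 2) L) (hchar : ∀ y : ↥(unipDeltaLoc L e dV hdV dW hdW v₀), conj (unipDeltaChar L e dV hdV dW hdW X (locToAdelic L e dV hdV dW hdW v₀ (y : UnitaryGroup.localPi L (IsCMField.complexConj L) (2 + 2) (hermD L e dV hdV dW hdW) v₀)) : ℂ) = conj ((ψ (σ * (e3.symm y).1) : ℂ))) :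
    haveI : Algebra.IsQuadraticExtension (Fp L) L := IsCMField.isQuadraticExtension L
    ∃ (A : GL (Fin 2) (UnitaryGroup.LocalRing L v₀)) (N₁ N₂ N₃ : ℂ → UnitaryGroup.localPi L (IsCMField.complexConj L) (2 + 2) (hermD L e dV hdV dW hdW) v₀ → ℂ) (κ : ℂ → ℂ),
      A.val = !![1 - Pi.single w 1, Pi.single w 1; Pi.single w 1, 1 - Pi.single w 1] ∧
      (∀ (s₀ : ℂ) (g : UnitaryGroup.localPi L (IsCMField.complexConj L) (2 + 2) (hermD L e dV hdV dW hdW) v₀), IsQRationalRegularAt (residueFieldCard (v₀.adicCompletion (Fp L))) s₀ fun s => N₂ s g) ∧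
      (∀ (s₀ : ℂ) (g : UnitaryGroup.localPi L (IsCMField.complexConj L) (2 + 2) (hermD L e dV hdV dW hdW) v₀), IsQRationalRegularAt (residueFieldCard (v₀.adicCompletion (Fp L))) s₀ fun s => N₃ s g) ∧
      (∀ s₀ : ℂ, 0 < s₀.re → IsQRationalRegularAt (residueFieldCard (v₀.adicCompletion (Fp L))) s₀ κ) ∧
      (∀ h : UnitaryGroup.localPi L (IsCMField.complexConj L) (2 + 2) (hermD L e dV hdV dW hdW) v₀, DifferentiableOn ℂ (fun s => κ s * N₃ s h) {s : ℂ | 0 < s.re}) ∧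
      (∀ s : ℂ, 1 < s.re → ∀ h : UnitaryGroup.localPi L (IsCMField.complexConj L) (2 + 2) (hermD L e dV hdV dW hdW) v₀,
        ∫ u, conj (unipDeltaChar L e dV hdV dW hdW X (locToAdelic L e dV hdV dW hdW v₀ (u : UnitaryGroup.localPi L (IsCMField.complexConj L) (2 + 2) (hermD L e dV hdV dW hdW) v₀)) : ℂ) * f s (UnitaryGroup.evalPlace (Fp L) L (IsCMField.complexConj L) (2 + 2) (hermD L e dV hdV dW hdW) v₀ (UnitaryGroup.finPart (Fp L) L (IsCMField.complexConj L) (2 + 2) (hermD L e dV hdV dW hdW) (Literature.NumberTheory.K2Lit.SiegelDoubled.weylDelta L e dV hdV dW hdW)) * (u : UnitaryGroup.localPi L (IsCMField.complexConj L) (2 + 2) (hermD L e dV hdV dW hdW) v₀) * h) ∂νN = κ s * N₃ s h) ∧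
      (∀ s : ℂ, 1 < s.re → ∀ h : UnitaryGroup.localPi L (IsCMField.complexConj L) (2 + 2) (hermD L e dV hdV dW hdW) v₀,
        Integrable (fun x => conj ((ψ (σ * x) : ℂ)) * N₂ s (FrameTransport.frameConj (Fp L) L (IsCMField.complexConj L) v₀ (2 + 2) (hermD_eq_map_gramD L e dV hdV dW hdW) (antidiagonal_over_eq_map (Fp L) L 2) Q hQ (toLocalFour (Fp L) L (IsCMField.complexConj L) v₀ (weylTwo (UnitaryGroup.LocalRing L v₀) (UnitaryGroup.conjLocal L (IsCMField.complexConj L) v₀))) * FrameTransport.frameConj (Fp L) L (IsCMField.complexConj L) v₀ (2 + 2) (hermD_eq_map_gramD L e dV hdV dW hdW) (antidiagonal_over_eq_map (Fp L) L 2) Q hQ (toLocalFour (Fp L) L (IsCMField.complexConj L) v₀ (uLongTwo (UnitaryGroup.LocalRing L v₀) (UnitaryGroup.conjLocal L (IsCMField.complexConj L) v₀) (UnitaryGroup.toLocalRing L v₀ x * algebraMap L (UnitaryGroup.LocalRing L v₀) (imagUnit L)) (conjLocal_coord (Fp L) L (IsCMField.complexConj L) (complexConj_imagUnit L) v₀ x)))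 * h)) μF ∧
          ∫ x, conj ((ψ (σ * x) : ℂ)) * N₂ s (FrameTransport.frameConj (Fp L) L (IsCMField.complexConj L) v₀ (2 + 2) (hermD_eq_map_gramD L e dV hdV dW hdW) (antidiagonal_over_eq_map (Fp L) L 2) Q hQ (toLocalFour (Fp L) L (IsCMField.complexConj L) v₀ (weylTwo (UnitaryGroup.LocalRing L v₀) (UnitaryGroup.conjLocal L (IsCMField.complexConj L) v₀))) * FrameTransport.frameConj (Fp L) L (IsCMField.complexConj L) v₀ (2 + 2) (hermD_eq_map_gramD L e dV hdV dW hdW) (antidiagonal_over_eq_map (Fp L) L 2) Q hQ (toLocalFour (Fp L) L (IsCMField.complexConj L) v₀ (uLongTwo (UnitaryGroup.LocalRing L v₀) (UnitaryGroup.conjLocal L (IsCMField.complexConj L) v₀) (UnitaryGroup.toLocalRing L v₀ x * algebraMap L (UnitaryGroup.LocalRing L v₀) (imagUnit L)) (conjLocal_coord (Fp L) L (IsCMField.complexConj L) (complexConj_imagUnit L) v₀ x))) * h) ∂μF = N₃ s h) ∧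
      (∀ s₀ : ℂ, (∀ g : UnitaryGroup.localPi L (IsCMField.complexConj L) (2 + 2) (hermD L e dV hdV dW hdW) v₀, N₂ s₀ g = 0) → ∀ h : UnitaryGroup.localPi L (IsCMField.complexConj L) (2 + 2) (hermD L e dV hdV dW hdW) v₀, N₃ s₀ h = 0) ∧
      (∀ s : ℂ, 1 < s.re →
        (∀ g : UnitaryGroup.localPi L (IsCMField.complexConj L) (2 + 2) (hermD L e dV hdV dW hdW) v₀, N₁ s g = (lF (Fp L) L v₀ χv (2 * s + 1))⁻¹ * ∫ y, f s (FrameTransport.frameConj (Fp L) L (IsCMField.complexConj L) v₀ (2 + 2) (hermD_eq_map_gramD L e dV hdV dW hdW) (antidiagonal_over_eq_map (Fp L) L 2) Q hQ (toLocalFour (Fp L) L (IsCMField.complexConj L) v₀ (weylTwo (UnitaryGroup.LocalRing L v₀) (UnitaryGroup.conjLocal L (IsCMField.complexConj L) v₀))) * FrameTransport.frameConj (Fp L) L (IsCMField.complexConj L) v₀ (2 + 2) (hermD_eq_map_gramD L e dV hdV dW hdW) (antidiagonal_over_eq_map (Fp L) L 2) Q hQ (toLocalFour (Fp L) L (IsCMField.complexConj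 L) v₀ (uLongTwo (UnitaryGroup.LocalRing L v₀) (UnitaryGroup.conjLocal L (IsCMField.complexConj L) v₀) (UnitaryGroup.toLocalRing L v₀ y * algebraMap L (UnitaryGroup.LocalRing L v₀) (imagUnit L)) (conjLocal_coord (Fp L) L (IsCMField.complexConj L) (complexConj_imagUnit L) v₀ y))) * g) ∂μF) ∧
        (∀ g : UnitaryGroup.localPi L (IsCMField.complexConj L) (2 + 2) (hermD L e dV hdV dW hdW) v₀, N₂ s g = (lEN (Fp L) L (IsCMField.complexConj L) v₀ χv (2 * s))⁻¹ * ∫ ζ, N₁ s (FrameTransport.frameConj (Fp L) L (IsCMField.complexConj L) v₀ (2 + 2) (hermD_eq_map_gramD L e dV hdV dW hdW) (antidiagonal_over_eq_map (Fp L) L 2) Q hQ (toLocalFour (Fp L) L (IsCMField.complexConj L) v₀ (leviElt (UnitaryGroup.LocalRing L v₀) (UnitaryGroup.conjLocal L (IsCMField.complexConj L) v₀) (UnitaryGroup.conjLocal_conjLocal (IsCMField.complexConj L) v₀ (complexConj_imagUnit L) (imagUnit_ne_zero L)) A)) * FrameTransport.frameConj (Fp L) L (IsCMField.complexConj L) v₀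 (2 + 2) (hermD_eq_map_gramD L e dV hdV dW hdW) (antidiagonal_over_eq_map (Fp L) L 2) Q hQ (toLocalFour (Fp L) L (IsCMField.complexConj L) v₀ (uMinus (UnitaryGroup.LocalRing L v₀) (UnitaryGroup.conjLocal L (IsCMField.complexConj L) v₀) (UnitaryGroup.conjLocal_conjLocal (IsCMField.complexConj L) v₀ (complexConj_imagUnit L) (imagUnit_ne_zero L)) (Pi.single w ζ))) * g) ∂μw)) ∧
      (∃ cN : ℝ≥0, 0 < cN ∧ ∀ s : ℂ, κ s = localSiegelCharacter (Fp L) L (IsCMField.complexConj L) v₀ 2 χv s (UnitaryGroup.evalPlace (Fp L) L (IsCMField.complexConj L) (2 + 2) (hermD L e dV hdV dW hdW) v₀ (UnitaryGroup.finPart (Fp L) L (IsCMField.complexConj L) (2 + 2) (hermD L e dV hdV dW hdW) (Literature.NumberTheory.K2Lit.SiegelDoubled.weylDelta L e dV hdV dW hdW)) * FrameTransport.frameConj (Fp L) L (IsCMField.complexConj L) v₀ (2 + 2) (hermD_eq_map_gramD L e dV hdV dW hdW) (antidiagonal_over_eq_map (Fp L) L 2) Q hQ (toLocalFour (Fp L)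 L (IsCMField.complexConj L) v₀ (weylSiegel (UnitaryGroup.LocalRing L v₀) (UnitaryGroup.conjLocal L (IsCMField.complexConj L) v₀)))) * (((cN : ℝ) : ℂ) * (lF (Fp L) L v₀ χv (2 * s + 1) * lEN (Fp L) L (IsCMField.complexConj L) v₀ χv (2 * s)))) := by
  haveI : Algebra.IsQuadraticExtension (Fp L) L := IsCMField.isQuadraticExtension L
  obtain ⟨A, N₁, N₂, N₃, κ, hA, hN₂, hN₃, hκ, hdiff, hiii, hN₃int, hvan, hform, hcN⟩ :=
    exists_twoStep_reading_unipDeltaLoc_cm L e dV hdV dW hdW v₀ D Dinv hDD Q hQm hQ νN μF χv hχ K₀ hK₀ hIw f hSieg hsm hflat e3 he3 he3mul ψ hψ hmψ hσ w hw μw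
  refine ⟨A, N₁, N₂, N₃, κ, hA, hN₂, hN₃, hκ, hdiff, fun s hs h => ?_, hN₃int, hvan, hform, hcN⟩
  rw [← hiii s hs h]
  exact integral_congr_ae (ae_of_all _ fun u => by beta_reduce; rw [hchar u])

end Full

end Summit.HodgeConjecture.HodgeConjecture.Cruxes.HLiu418.K2LiuSingularWhittakerTailGlue

end
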